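import Mathlib
import Summits.Ventures.HodgeRepro.Tier4.Common.AdelicDefs
import Summits.Ventures.HodgeRepro.Tier4.Common.AdelicHaar
import Summits.Ventures.HodgeRepro.Tier4.Line1.PlaneDefs
import Summits.Ventures.HodgeRepro.Tier4.Line1.RotationGram
import Summits.Ventures.HodgeRepro.Tier4.Line1.RationalRotation
import Summits.Ventures.HodgeRepro.Tier4.Line1.WittPlane
import Summits.Ventures.HodgeRepro.Tier4.Line1.StabLine
import Summits.Ventures.HodgeRepro.Tier4.Line1.NormOneTorusAlgebra
import Summits.Ventures.HodgeRepro.Tier4.Line1.NormOneTorus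
import Summits.Ventures.HodgeRepro.Tier4.Line1.TorusBlock

/-!
# Tier4/Line1/StabBridge — the bridge (i)+(ii) ⇒ `hstab`: the adelic stabiliser of a rational vector is `Stab(v)(k) · K`

Blind re-derivation cell `pub-hodge-repro`, Tier 4 «PROVE THE STEP» (README §9–§10), LINE L1, seat t4-L1-p3 (prover);
the bridge claimed in S12962 (lead g385 R-II; p5 S12955, p2 S12952). For a genuine definite plane `W` and a non-zero
rational row vector `v`: pick a rational `w ≠ 0` on `v^⊥` (`exists_orth_ne_zero`, WittPlane p670389); the adapted rows
`S = (v, vΩ, w, wΩ)` satisfy `S Ω = Jd S` and `S B Sᵀ = diag(α, dα, α′, dα′)` (`gram_adapted`, RotationGram p667326),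
so `det S ≠ 0` (definiteness). Every `s ∈ U(W)(𝔸_k)` fixing `v` acts on `w` by a norm-one pair `(x, y)` (rung (i),
`stab_line_scalar`, StabLine p671814), hence `mat s = S⁻¹ diag(1, 1, ρ(x, y)) S` (`exists_mat_eq_conjBlock`). Rung (ii),
Fujisaki for the norm-one torus (`normOneTorusCocompact`, NormOneTorus p672727, t4-L1-p5; t4-L1-p2's
`exists_compact_normOne_eq_rational_mul`, TorusFujisaki p672614, is the lemma of record for the same statement on
`Ad k × Ad k`), writes `(x, y) = γ · c` with `γ ∈ E′¹(k)` and `c` in a compact `C`; the torus map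
`c ↦ S⁻¹ diag(1, 1, ρ(c)) S` (`torusGA`) is continuous into `U(W)(𝔸_k)`, so `K := torusGA(C ∩ {norm 1})` is compact,
`γ̃ := torusGA(γ)` is a rational point fixing `v`, and `s = γ̃ · torusGA(c)` (`hstab_of_rungs`, the binder `hstab` of
`quotient_compact_of_rungs` VERBATIM). Mathlib + the line's landed modules only; no printed input.

Nothing here says anything about the status of the Hodge conjecture for CM abelian varieties, which is NOT proved
(HC_CM is NOT proved by anyone in this repository).
-/

set_option autoImplicit false

noncomputable section

namespace Summit.Ventures.HodgeRepro.Tier4.Line1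

open NumberField Summit.Ventures.HodgeRepro.Tier4.Common Matrix Rot

variable {k : Type} [Field k] (W : PlaneData k)

/-- The adapted basis `(v, vΩ, w, wΩ)` of the plane as the rows of a matrix (row convention). -/
def adaptedRows (v w : Fin 4 → k) : Matrix (Fin 4) (Fin 4) k := Matrix.of ![v, v ᵥ* W.Ω, w, w ᵥ* W.Ω]

/-- Row `0` of the adapted rows is `v`. -/
theorem adaptedRows_zero (v w : Fin 4 → k) : adaptedRows W v w 0 = v := rfl
/-- Row `1` of the adapted rows is `vΩ`. -/
theorem adaptedRows_one (v w : Fin 4 → k) : adaptedRows W v w 1 = v ᵥ* W.Ω := rfl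
/-- Row `2` of the adapted rows is `w`. -/
theorem adaptedRows_two (v w : Fin 4 → k) : adaptedRows W v w 2 = w := rfl
/-- Row `3` of the adapted rows is `wΩ`. -/
theorem adaptedRows_three (v w : Fin 4 → k) : adaptedRows W v w 3 = w ᵥ* W.Ω := rfl

/-- `Ω` acts on the adapted basis by `diag(J_d, J_d)`: `S Ω = J_d S`. -/
theorem adaptedRows_mul_Ω {d : k} (hΩ : W.Ω * W.Ω = -(d • (1 : Matrix (Fin 4) (Fin 4) k))) (v w : Fin 4 → k) :
    adaptedRows W v w * W.Ω = Jd d * adaptedRows W v w := by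
  have h : ∀ u : Fin 4 → k, (u ᵥ* W.Ω) ᵥ* W.Ω = -(d • u) := fun u => by
    rw [Matrix.vecMul_vecMul, hΩ, Matrix.vecMul_neg, Matrix.vecMul_smul, Matrix.vecMul_one]
  have e0 : (adaptedRows W v w * W.Ω) 0 = (Jd d * adaptedRows W v w) 0 := by
    rw [mul_row, Jd_mul_row_zero, adaptedRows_zero, adaptedRows_one]
  have e1 : (adaptedRows W v w * W.Ω) 1 = (Jd d * adaptedRows W v w) 1 := by
    rw [mul_row, Jd_mul_row_one, adaptedRows_one, adaptedRows_zero, h]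
  have e2 : (adaptedRows W v w * W.Ω) 2 = (Jd d * adaptedRows W v w) 2 := by
    rw [mul_row, Jd_mul_row_two, adaptedRows_two, adaptedRows_three]
  have e3 : (adaptedRows W v w * W.Ω) 3 = (Jd d * adaptedRows W v w) 3 := by
    rw [mul_row, Jd_mul_row_three, adaptedRows_three, adaptedRows_two, h]
  funext i
  fin_cases i
  · exact e0
  · exact e1
  · exact e2
  · exact e3

/-- The adapted rows are the transpose of the column matrix of `gram_adapted` (with `Om = Ωᵀ`). -/
theorem adaptedRows_eq_transpose (v w : Fin 4 → k) :
    adaptedRows W v w = (Matrix.of fun i j => ![v, W.Ωᵀ *ᵥ v, w, W.Ωᵀ *ᵥ w] j i)ᵀ := by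
  ext i j
  simp only [adaptedRows, Matrix.transpose_apply, Matrix.of_apply, Matrix.mulVec_transpose]

/-- **The Gram matrix of the adapted basis** (row convention): `S B Sᵀ = diag(α, dα, α′, dα′)`. -/
theorem adaptedRows_gram [NumberField k] (hg : IsGenuineRow W) {d : k}
    (hΩ : W.Ω * W.Ω = -(d • (1 : Matrix (Fin 4) (Fin 4) k))) {v w : Fin 4 → k}
    (hwv : w ⬝ᵥ (W.B *ᵥ v) = 0) (hwΩv : w ⬝ᵥ (W.B *ᵥ (W.Ωᵀ *ᵥ v)) = 0) :
    adaptedRows W v w * W.B * (adaptedRows W v w)ᵀ =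
      Matrix.diagonal ![v ⬝ᵥ (W.B *ᵥ v), d * (v ⬝ᵥ (W.B *ᵥ v)), w ⬝ᵥ (W.B *ᵥ w), d * (w ⬝ᵥ (W.B *ᵥ w))] := by
  obtain ⟨-, hrow, -, -, -, -⟩ := hg
  have hOm : W.Ωᵀ * W.Ωᵀ = -(d • (1 : Matrix (Fin 4) (Fin 4) k)) := by
    rw [← Matrix.transpose_mul, hΩ, Matrix.transpose_neg, Matrix.transpose_smul, Matrix.transpose_one]
  have hherm : W.Ωᵀᵀ * W.B = -(W.B * W.Ωᵀ) := by
    rw [Matrix.transpose_transpose]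
    exact hrow
  have hvw : v ⬝ᵥ (W.B *ᵥ w) = 0 := by rw [pair_comm W.B_symm]; exact hwv
  have hvOw : v ⬝ᵥ (W.B *ᵥ (W.Ωᵀ *ᵥ w)) = 0 := by
    rw [← neg_eq_zero, ← pair_mulVec_left hherm, pair_comm W.B_symm]
    exact hwΩv
  have hG := gram_adapted W.B_symm hherm hOm v w hvw hvOw
  rw [adaptedRows_eq_transpose, Matrix.transpose_transpose]
  exact hG

/-- The adapted rows form a basis: `det S ≠ 0` (definiteness). -/
theorem adaptedRows_det_ne_zero [NumberField k] (hW : IsDefinite W) (hg : IsGenuineRow W) {d : k}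
    (hΩ : W.Ω * W.Ω = -(d • (1 : Matrix (Fin 4) (Fin 4) k))) (hd : ¬ IsSquare (-d)) {v w : Fin 4 → k} (hv : v ≠ 0)
    (hw : w ≠ 0) (hwv : w ⬝ᵥ (W.B *ᵥ v) = 0) (hwΩv : w ⬝ᵥ (W.B *ᵥ (W.Ωᵀ *ᵥ v)) = 0) :
    (adaptedRows W v w).det ≠ 0 := by
  intro h0
  have hG := adaptedRows_gram W hg hΩ hwv hwΩv
  have hα : v ⬝ᵥ (W.B *ᵥ v) ≠ 0 := pair_self_ne_zero_of_isDefinite W hW hv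
  have hα' : w ⬝ᵥ (W.B *ᵥ w) ≠ 0 := pair_self_ne_zero_of_isDefinite W hW hw
  have hd0 : d ≠ 0 := by
    rintro rfl
    exact hd ⟨0, by simp⟩
  have hdet := congrArg Matrix.det hG
  rw [Matrix.det_mul, Matrix.det_mul, Matrix.det_transpose, h0, zero_mul, zero_mul, Matrix.det_diagonal,
    Fin.prod_univ_four] at hdet
  simp only [Matrix.cons_val_zero, Matrix.cons_val_one, Matrix.head_cons, Matrix.cons_val_two,
    Matrix.cons_val_three, Matrix.tail_cons] at hdet
  exact (mul_ne_zero (mul_ne_zero (mul_ne_zero hα (mul_ne_zero hd0 hα)) hα') (mul_ne_zero hd0 hα')) hdet.symm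

section Adelic

variable [NumberField k]

/-- `adMat` of `Jd`. -/
theorem adMat_Jd (d : k) : adMat k (Jd d) = Jd (algebraMap k (Ad k) d) := by
  ext i j
  fin_cases i <;> fin_cases j <;> simp [adMat, Jd]

/-- `adMat` of `torusBlock`. -/
theorem adMat_torusBlock (d : k) (c : Fin 2 → k) :
    adMat k (torusBlock d c) = torusBlock (algebraMap k (Ad k) d) (fun i => algebraMap k (Ad k) (c i)) := by
  ext i j
  fin_cases i <;> fin_cases j <;> simp [adMat, torusBlock]

/-- The adapted rows read adelically. -/
abbrev adS (v w : Fin 4 → k) : M4 k := adMat k (adaptedRows W v w)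

/-- The inverse of the adapted rows read adelically. -/
abbrev adS' (v w : Fin 4 → k) : M4 k := adMat k (adaptedRows W v w)⁻¹

variable {W}

/-- `S · S⁻¹ = 1` adelically. -/
theorem adS_mul_adS' {v w : Fin 4 → k} (hdet : (adaptedRows W v w).det ≠ 0) : adS W v w * adS' W v w = 1 := by
  rw [adS, adS', ← adMat_mul, Matrix.mul_nonsing_inv _ (isUnit_iff_ne_zero.mpr hdet), adMat_one]

/-- `S⁻¹ · S = 1` adelically. -/
theorem adS'_mul_adS {v w : Fin 4 → k} (hdet : (adaptedRows W v w).det ≠ 0) : adS' W v w * adS W v w = 1 := by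
  rw [adS, adS', ← adMat_mul, Matrix.nonsing_inv_mul _ (isUnit_iff_ne_zero.mpr hdet), adMat_one]

/-- `S Ω = Jd S` adelically. -/
theorem adS_mul_Ω {d : k} (hΩ : W.Ω * W.Ω = -(d • (1 : Matrix (Fin 4) (Fin 4) k))) (v w : Fin 4 → k) :
    adS W v w * adMat k W.Ω = Jd (algebraMap k (Ad k) d) * adS W v w := by
  rw [adS, ← adMat_mul, adaptedRows_mul_Ω W hΩ, adMat_mul, adMat_Jd]

/-- The adapted Gram matrix adelically: `S B Sᵀ = diag(α, dα, α′, dα′)` read through `algebraMap`. -/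
theorem adS_gram (hg : IsGenuineRow W) {d : k} (hΩ : W.Ω * W.Ω = -(d • (1 : Matrix (Fin 4) (Fin 4) k)))
    {v w : Fin 4 → k} (hwv : w ⬝ᵥ (W.B *ᵥ v) = 0) (hwΩv : w ⬝ᵥ (W.B *ᵥ (W.Ωᵀ *ᵥ v))= 0) :
    adS W v w * adMat k W.B * (adS W v w)ᵀ =
      Matrix.diagonal ![algebraMap k (Ad k) (v ⬝ᵥ (W.B *ᵥ v)),
        algebraMap k (Ad k) d * algebraMap k (Ad k) (v ⬝ᵥ (W.B *ᵥ v)), algebraMap k (Ad k) (w ⬝ᵥ (W.B *ᵥ w)),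
        algebraMap k (Ad k) d * algebraMap k (Ad k) (w ⬝ᵥ (W.B *ᵥ w))] := by
  rw [adS, ← adMat_transpose, ← adMat_mul, ← adMat_mul, adaptedRows_gram W hg hΩ hwv hwΩv, adMat,
    Matrix.diagonal_map (map_zero _)]
  congr 1
  funext i
  fin_cases i <;> simp

/-- **The torus element** `S⁻¹ diag(1, 1, ρ(c)) S ∈ GL₄(𝔸_k)` of a norm-one adelic pair `c` (inverse: the conjugate
pair). -/
def torusGL (d : k) (v w : Fin 4 → k) (hdet : (adaptedRows W v w).det ≠ 0)
    (c : {c : Fin 2 → Ad k // qnorm (algebraMap k (Ad k) d) c = 1}) : GL4 k :=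
  ⟨conjBlock (adS W v w) (adS' W v w) (algebraMap k (Ad k) d) c.1,
   conjBlock (adS W v w) (adS' W v w) (algebraMap k (Ad k) d) (qconj c.1),
   by rw [conjBlock_mul _ (adS_mul_adS' hdet), qmul_qconj_self_of_qnorm_eq_one _ c.2,
     conjBlock_qone _ (adS'_mul_adS hdet)],
   by rw [conjBlock_mul _ (adS_mul_adS' hdet), qmul_comm, qmul_qconj_self_of_qnorm_eq_one _ c.2,
     conjBlock_qone _ (adS'_mul_adS hdet)]⟩

/-- The matrix of `torusGL`. -/
theorem torusGL_val (d : k) (v w : Fin 4 → k) (hdet : (adaptedRows W v w).det ≠ 0)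
    (c : {c : Fin 2 → Ad k // qnorm (algebraMap k (Ad k) d) c = 1}) :
    (torusGL d v w hdet c : M4 k) = conjBlock (adS W v w) (adS' W v w) (algebraMap k (Ad k) d) c.1 := rfl

/-- The matrix of the inverse of `torusGL`: the conjugate pair. -/
theorem torusGL_inv_val (d : k) (v w : Fin 4 → k) (hdet : (adaptedRows W v w).det ≠ 0)
    (c : {c : Fin 2 → Ad k // qnorm (algebraMap k (Ad k) d) c = 1}) :
    ((torusGL d v w hdet c)⁻¹ : GL4 k).val =
      conjBlock (adS W v w) (adS' W v w) (algebraMap k (Ad k) d) (qconj c.1) := rfl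

/-- **The torus element in `U(W)(𝔸_k)`**: for a norm-one pair `c`, `S⁻¹ diag(1, 1, ρ(c)) S` commutes with `Ω` and
preserves `B`. -/
def torusGA (d : k) (v w : Fin 4 → k) (hdet : (adaptedRows W v w).det ≠ 0)
    (hΩ : W.Ω * W.Ω = -(d • (1 : Matrix (Fin 4) (Fin 4) k))) {a a' : Ad k}
    (hgram : adS W v w * adMat k W.B * (adS W v w)ᵀ =
      Matrix.diagonal ![a, algebraMap k (Ad k) d * a, a', algebraMap k (Ad k) d * a'])
    (c : {c : Fin 2 → Ad k // qnorm (algebraMap k (Ad k) d) c = 1}) : GA W :=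
  ⟨torusGL d v w hdet c, (mem_unitaryGroup W _).mpr
    ⟨conjBlock_comm _ (adS_mul_adS' hdet) (adS'_mul_adS hdet) (adS_mul_Ω hΩ v w) c.1,
     conjBlock_isometry _ (adS_mul_adS' hdet) (adS'_mul_adS hdet) hgram c.2⟩⟩

/-- The matrix of `torusGA`. -/
theorem torusGA_mat (d : k) (v w : Fin 4 → k) (hdet : (adaptedRows W v w).det ≠ 0)
    (hΩ : W.Ω * W.Ω = -(d • (1 : Matrix (Fin 4) (Fin 4) k))) {a a' : Ad k}
    (hgram : adS W v w * adMat k W.B * (adS W v w)ᵀ =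
      Matrix.diagonal ![a, algebraMap k (Ad k) d * a, a', algebraMap k (Ad k) d * a'])
    (c : {c : Fin 2 → Ad k // qnorm (algebraMap k (Ad k) d) c = 1}) :
    GA.mat W (torusGA d v w hdet hΩ hgram c) = conjBlock (adS W v w) (adS' W v w) (algebraMap k (Ad k) d) c.1 :=
  rfl

/-- `torusBlock` is continuous in the pair. -/
theorem continuous_torusBlock (d : Ad k) : Continuous fun c : Fin 2 → Ad k => torusBlock d c := by
  refine continuous_matrix fun i j => ?_
  fin_cases i <;> fin_cases j <;> simp [torusBlock] <;> fun_prop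

/-- `conjBlock` is continuous in the pair. -/
theorem continuous_conjBlock (S S' : M4 k) (d : Ad k) : Continuous fun c : Fin 2 → Ad k => conjBlock S S' d c :=
  (continuous_const.matrix_mul (continuous_torusBlock d)).matrix_mul continuous_const

/-- **The torus map is continuous** into `U(W)(𝔸_k)`. -/
theorem continuous_torusGA (d : k) (v w : Fin 4 → k) (hdet : (adaptedRows W v w).det ≠ 0)
    (hΩ : W.Ω * W.Ω = -(d • (1 : Matrix (Fin 4) (Fin 4) k))) {a a' : Ad k}
    (hgram : adS W v w * adMat k W.B * (adS W v w)ᵀ =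
      Matrix.diagonal ![a, algebraMap k (Ad k) d * a, a', algebraMap k (Ad k) d * a']) :
    Continuous (torusGA d v w hdet hΩ hgram) := by
  refine Continuous.subtype_mk ?_ _
  refine Units.continuous_iff.mpr ⟨?_, ?_⟩
  · exact (continuous_conjBlock _ _ _).comp continuous_subtype_val
  · exact (continuous_conjBlock _ _ _).comp (continuous_qconj.comp continuous_subtype_val)

end Adelic

section Bridge

variable [NumberField k]

/-- Row `0` of the adelic adapted rows is `v` read adelically. -/
theorem adS_zero (v w : Fin 4 → k) : adS W v w 0 = fun i => algebraMap k (Ad k) (v i) := rfl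

/-- Row `2` of the adelic adapted rows is `w` read adelically. -/
theorem adS_two (v w : Fin 4 → k) : adS W v w 2 = fun i => algebraMap k (Ad k) (w i) := rfl

/-- Row `1` of the adelic adapted rows is `vΩ` read adelically. -/
theorem adS_one (v w : Fin 4 → k) :
    adS W v w 1 = (fun i => algebraMap k (Ad k) (v i)) ᵥ* adMat k W.Ω :=
  funext fun i => RingHom.map_vecMul (algebraMap k (Ad k)) W.Ω v i

/-- Row `3` of the adelic adapted rows is `wΩ` read adelically. -/
theorem adS_three (v w : Fin 4 → k) :
    adS W v w 3 = (fun i => algebraMap k (Ad k) (w i)) ᵥ* adMat k W.Ω :=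
  funext fun i => RingHom.map_vecMul (algebraMap k (Ad k)) W.Ω w i

/-- `adMat` of `−(d • 1)`. -/
theorem adMat_neg_smul_one (d : k) :
    adMat k (-(d • (1 : Matrix (Fin 4) (Fin 4) k))) = -(algebraMap k (Ad k) d • (1 : M4 k)) := by
  ext i j
  simp only [adMat, Matrix.map_apply, Matrix.neg_apply, Matrix.smul_apply, Matrix.one_apply, smul_eq_mul, map_neg,
    map_mul]
  split_ifs <;> simp

/-- **Every element of the adelic stabiliser of `v` is a torus element**: `mat s = S⁻¹ diag(1, 1, ρ(t)) S` for the
norm-one pair `t = (x, y)` of rung (i) (`stab_line_scalar`). -/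
theorem exists_mat_eq_conjBlock (hW : IsDefinite W) (hg : IsGenuineRow W) {d : k}
    (hΩ : W.Ω * W.Ω = -(d • (1 : Matrix (Fin 4) (Fin 4) k))) {v w : Fin 4 → k} (hv : v ≠ 0) (hw : w ≠ 0)
    (hwv : w ⬝ᵥ (W.B *ᵥ v) = 0) (hwΩv : w ⬝ᵥ (W.B *ᵥ (W.Ωᵀ *ᵥ v)) = 0)
    (hdet : (adaptedRows W v w).det ≠ 0) (s : GA W)
    (hs : (fun i => algebraMap k (Ad k) (v i)) ᵥ* GA.mat W s = fun i => algebraMap k (Ad k) (v i)) :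
    ∃ t : Fin 2 → Ad k, qnorm (algebraMap k (Ad k) d) t = 1 ∧
      GA.mat W s = conjBlock (adS W v w) (adS' W v w) (algebraMap k (Ad k) d) t := by
  have hrow := hg.2.1
  -- the row forms of the orthogonality hypotheses
  have hwv' : w ᵥ* W.B ⬝ᵥ v = 0 := by rw [← Matrix.dotProduct_mulVec]; exact hwv
  have hwΩv' : (w ᵥ* W.Ω) ᵥ* W.B ⬝ᵥ v = 0 := by
    rw [Matrix.vecMul_vecMul, hrow, Matrix.vecMul_neg, neg_dotProduct, neg_eq_zero, ← Matrix.vecMul_vecMul,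
      ← Matrix.dotProduct_mulVec, ← Matrix.dotProduct_mulVec]
    exact hwΩv
  obtain ⟨x, y, hxy, hnorm⟩ := stab_line_scalar W hg hW hΩ hv hw hwv' hwΩv' s hs
  refine ⟨![x, y], by simp [qnorm, hnorm], ?_⟩
  have hcomm : GA.mat W s * adMat k W.Ω = adMat k W.Ω * GA.mat W s := ((mem_unitaryGroup W _).mp s.2).1
  have hΩΩ : adMat k W.Ω * adMat k W.Ω = -(algebraMap k (Ad k) d • (1 : M4 k)) := by
    rw [← adMat_mul, hΩ, adMat_neg_smul_one]
  -- the rows of `S · mat s`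
  have hmain : adS W v w * GA.mat W s = torusBlock (algebraMap k (Ad k) d) ![x, y] * adS W v w := by
    have e0 : (adS W v w * GA.mat W s) 0 = (torusBlock (algebraMap k (Ad k) d) ![x, y] * adS W v w) 0 := by
      rw [mul_row, torusBlock_mul_row_zero, adS_zero, hs]
    have e1 : (adS W v w * GA.mat W s) 1 = (torusBlock (algebraMap k (Ad k) d) ![x, y] * adS W v w) 1 := by
      rw [mul_row, torusBlock_mul_row_one, adS_one, Matrix.vecMul_vecMul, ← hcomm, ← Matrix.vecMul_vecMul, hs]
    have e2 : (adS W v w * GA.mat W s) 2 = (torusBlock (algebraMap k (Ad k) d) ![x, y] * adS W v w) 2 := by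
      rw [mul_row, torusBlock_mul_row_two, adS_two, adS_three, hxy]
      simp
    have e3 : (adS W v w * GA.mat W s) 3 = (torusBlock (algebraMap k (Ad k) d) ![x, y] * adS W v w) 3 := by
      rw [mul_row, torusBlock_mul_row_three, adS_three, adS_two, Matrix.vecMul_vecMul, ← hcomm,
        ← Matrix.vecMul_vecMul, hxy, Matrix.add_vecMul, Matrix.smul_vecMul, Matrix.smul_vecMul,
        Matrix.vecMul_vecMul, hΩΩ, Matrix.vecMul_neg, Matrix.vecMul_smul, Matrix.vecMul_one]
      simp only [Matrix.cons_val_zero, Matrix.cons_val_one]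
      ext i
      simp only [Pi.add_apply, Pi.smul_apply, Pi.neg_apply, smul_eq_mul]
      ring
    funext i
    fin_cases i
    · exact e0
    · exact e1
    · exact e2
    · exact e3
  calc GA.mat W s = (adS' W v w * adS W v w) * GA.mat W s := by rw [adS'_mul_adS hdet, Matrix.one_mul]
    _ = adS' W v w * (adS W v w * GA.mat W s) := by rw [Matrix.mul_assoc]
    _ = conjBlock (adS W v w) (adS' W v w) (algebraMap k (Ad k) d) ![x, y] := by
        rw [hmain, conjBlock, Matrix.mul_assoc]

/-- **THE BRIDGE (i)+(ii) ⇒ `hstab`**: for every non-zero rational `v`, the adelic stabiliser of `v` in `U(W)(𝔸_k)` is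
`Stab(v)(k) · K` for a compact `K`. The stabiliser is the norm-one torus of `E′ = k(Ω)` acting on the line `v^⊥`
(rung (i), `stab_line_scalar`, StabLine p671814); its rational points are cocompact (rung (ii): Fujisaki for the norm-one
torus, `normOneTorusCocompact` (NormOneTorus p672727, t4-L1-p5) — t4-L1-p2's `exists_compact_normOne_eq_rational_mul`
(TorusFujisaki p672614) is the lemma of record, the same statement on `Ad k × Ad k`); the compact `K` is the image of
rung (ii)'s compact under the continuous torus map `c ↦ S⁻¹ diag(1, 1, ρ(c)) S`. The statement is the binder `hstab` of
`quotient_compact_of_rungs` (Skeleton L657–L660) and of `cocompact_rationalPoints_of_rungs` (CocompactAssembly L171)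
VERBATIM. -/
theorem hstab_of_rungs (hW : IsDefinite W) (hg : IsGenuineRow W) :
    ∀ v : Fin 4 → k, v ≠ 0 → ∃ K : Set (GA W), IsCompact K ∧ ∀ s : GA W,
      (fun i => algebraMap k (Ad k) (v i)) ᵥ* GA.mat W s = (fun i => algebraMap k (Ad k) (v i)) →
        ∃ γ : rationalPoints W, (fun i => algebraMap k (Ad k) (v i)) ᵥ* GA.mat W (γ : GA W) =
          (fun i => algebraMap k (Ad k) (v i)) ∧ ∃ κ ∈ K, s = (γ : GA W) * κ := by
  intro v hv
  obtain ⟨d, hΩ, hd⟩ := hg.1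
  obtain ⟨w, hw, hwv, hwΩv⟩ := exists_orth_ne_zero W.B W.Ωᵀ v
  have hdet : (adaptedRows W v w).det ≠ 0 := adaptedRows_det_ne_zero W hW hg hΩ hd hv hw hwv hwΩv
  have hgram := adS_gram hg hΩ hwv hwΩv
  obtain ⟨C, hC, hCt⟩ := normOneTorusCocompact (k := k) d hd
  haveI : T2Space (Ad k) := t2Space_adeleRing k
  have hclosed : IsClosed {c : Fin 2 → Ad k | qnorm (algebraMap k (Ad k) d) c = 1} :=
    isClosed_eq (continuous_qnorm _) continuous_const
  refine ⟨torusGA d v w hdet hΩ hgram '' (Subtype.val ⁻¹' C), ?_, ?_⟩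
  · exact ((Topology.IsClosedEmbedding.subtypeVal hclosed).isCompact_preimage hC).image
      (continuous_torusGA d v w hdet hΩ hgram)
  intro s hs
  obtain ⟨t, ht, hst⟩ := exists_mat_eq_conjBlock W hW hg hΩ hv hw hwv hwΩv hdet s hs
  obtain ⟨γ, hγ, c, hcC, hc1, htc⟩ := hCt t ht
  have hγ1 : qnorm (algebraMap k (Ad k) d) (fun i => algebraMap k (Ad k) (γ i)) = 1 := by
    rw [← qnorm_map (algebraMap k (Ad k)) d γ, hγ, map_one]
  -- the rational torus element over `k`
  have hSk : adaptedRows W v w * (adaptedRows W v w)⁻¹ = 1 :=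
    Matrix.mul_nonsing_inv _ (isUnit_iff_ne_zero.mpr hdet)
  have hSk' : (adaptedRows W v w)⁻¹ * adaptedRows W v w = 1 :=
    Matrix.nonsing_inv_mul _ (isUnit_iff_ne_zero.mpr hdet)
  let u : GL (Fin 4) k :=
    ⟨conjBlock (adaptedRows W v w) (adaptedRows W v w)⁻¹ d γ,
     conjBlock (adaptedRows W v w) (adaptedRows W v w)⁻¹ d (qconj γ),
     by rw [conjBlock_mul _ hSk, qmul_qconj_self_of_qnorm_eq_one _ hγ, conjBlock_qone _ hSk'],
     by rw [conjBlock_mul _ hSk, qmul_comm, qmul_qconj_self_of_qnorm_eq_one _ hγ, conjBlock_qone _ hSk']⟩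
  have hu : Matrix.GeneralLinearGroup.map (algebraMap k (Ad k)) u =
      (torusGA d v w hdet hΩ hgram ⟨fun i => algebraMap k (Ad k) (γ i), hγ1⟩ : GA W) := by
    apply Units.ext
    show (conjBlock (adaptedRows W v w) (adaptedRows W v w)⁻¹ d γ).map (algebraMap k (Ad k)) =
      conjBlock (adS W v w) (adS' W v w) (algebraMap k (Ad k) d) (fun i => algebraMap k (Ad k) (γ i))
    rw [conjBlock, conjBlock, ← adMat_torusBlock, adS, adS', ← adMat_mul, ← adMat_mul]
    rfl
  refine ⟨⟨torusGA d v w hdet hΩ hgram ⟨fun i => algebraMap k (Ad k) (γ i), hγ1⟩,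
    Subgroup.mem_subgroupOf.mpr (MonoidHom.mem_range.mpr ⟨u, hu⟩)⟩, ?_, torusGA d v w hdet hΩ hgram ⟨c, hc1⟩,
    ⟨⟨c, hc1⟩, hcC, rfl⟩, ?_⟩
  · -- the rational element fixes `v`
    show (fun i => algebraMap k (Ad k) (v i)) ᵥ* GA.mat W (torusGA d v w hdet hΩ hgram _) = _
    rw [torusGA_mat, ← adS_zero W v w, ← mul_row, mul_conjBlock _ (adS_mul_adS' hdet), torusBlock_mul_row_zero]
  · -- `s = γ̃ κ`
    apply Subtype.ext
    apply Units.ext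
    show GA.mat W s = GA.mat W (torusGA d v w hdet hΩ hgram _ * torusGA d v w hdet hΩ hgram _)
    rw [GA.mat_mul, torusGA_mat, torusGA_mat, conjBlock_mul _ (adS_mul_adS' hdet), hst, htc]
    rfl

end Bridge

end Summit.Ventures.HodgeRepro.Tier4.Line1

end

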